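import Summits.KontsevichZagierPeriods.KontsevichZagierPeriods.Theorems.LinRedNormalFormArrangementNormalFormSeparateThreeKPiece
import Summits.KontsevichZagierPeriods.KontsevichZagierPeriods.Theorems.LinRedNormalFormArrangementNormalFormSeparateHighFanActive
import Summits.KontsevichZagierPeriods.KontsevichZagierPeriods.Theorems.LinRedNormalFormArrangementNormalFormSeparateHighCandidates
import Summits.KontsevichZagierPeriods.KontsevichZagierPeriods.Theorems.LinRedNormalFormArrangementNormalFormSeparateBaseChange

/-!
# Separation in base dimension `≥ 3` WITH fibres, modulo the wall-invariant convergence lemma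
(stub `stub_separateHigh`, part `KAssembly`)

(Line `janus-bands`, crux `ArrangementNormalForm`, stub `stub_separateHigh` — separation in base
dimension `b + 3` with `k` fibres, `JJ (b + 3) k → closure (GG (b + 2) 1 k)`; part `KAssembly`.)

**Theorem** (`separateHigh_of_hH`, in the stub's vocabulary; `separateThreeK_of_hH`, registered,
in the engine's abbreviations). For EVERY `b` and `k`: GIVEN the termwise-convergence lemma of
the Taylor split under the WALL INVARIANT in engine base dimension `b + 3` — the hypothesis
`hHb`, universally closed: the registered statement of `stub_separateTwoPos_hI` with
`(hb : b' = 1)` replaced by `(hb : b' = b + 2)` — every absolutely convergent Janus band datum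
`[D × fibres, P/∏ L_j^{e_j} · (fibre block)]` over a bounded open rational polytope
`D ⊂ ℝ^{b+3}` with `k` Janus fibres (`JJ (b + 3) k`) is congruent modulo `KZ.relations` to a
`ℤ`-combination of SEPARATED data (`GG (b + 2) 1 k`). Hence the stub `stub_separateHigh`
FOLLOWS from the family of analytic lemmas `hH_{b+2}`, `b ≥ 0`, and nothing else; its part "base
dimension `3` with fibres" is `separateHigh_threeFibres_of_hHk` (`b = 0`, `k + 1` fibres), whose
hypothesis `hHk` is VERBATIM the with-fibres wall-invariant split lemma `separateThree_hHk` of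
parts `SeparateThreeHHK*` (the registered statement of `stub_separateTwoPos_hI` with `(hb : b = 2)`
in place of `(hb : b = 1)`; its rim-condition variant is FALSE with fibres: the fibre mass may
pinch at a two-dimensional letter contact, e.g. `[{0<x₁<1, 0<x₂<1, x₂<y<2, 0<t₁,t₂<x₁},
(y−x₂)/x₁² · ∏ᵢ 1/(tᵢ−(x₁+y−x₂))]`, whereas the wall-invariant form is exactly what the engine
delivers at its terminal pieces).

Proof = the far-first engine with the fibres riding along, uniformly in the dimension:
`separateHigh_fan_active` (`(B, k)`-generic: fan pieces with a rational direction `v` moving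
every active letter, on which the active letters do not vanish and satisfy the RATIO conditions
pairwise), the base change `separatePos_baseChange` along `v` (`SepHigh.dirAinv`; fibres
untouched; no cut), and the piece theorem `SepThreeK.piece` (part `KPiece`: contact-aware
engine `SepThree.sepC_induction`, splittable pairs by the ratio conditions alone —
`SepThreeK.hunb_of_ratio`, part `KUnblocked` —, terminal Taylor split under the wall invariant,
which is where `hHb` enters). Dimension-specific inputs of the fibre-free 3-d proof (thin/fat
contacts, special points, grids, the cancellation `Lᵉ ∣ P`) are not used.
-/

noncomputable section

open Set MeasureTheory Filter Topology

namespace Summit.KontsevichZagierPeriods.ArrangementNormalForm.JanusBands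

open Literature.NumberTheory.Transcendental

open SeparatePos SepHigh SepThree SepThreeK in
/-- **`JJ (b + 3) k → closure (GG (b + 2) 1 k)` modulo the wall-invariant convergence lemma in
engine base dimension `b + 3`** (registered part `separateThreeK_of_hH` of `stub_separateHigh`;
the datum in the engine's abbreviations `SeparatePos.gDom / affF / fib / GGset` at base parameter
`b + 2`, definitionally the literal `JJ (b + 3) k` datum): see the module docstring. -/
theorem separateThreeK_of_hH (b k : ℕ) (hHb : ∀ (b' k' m m' n : ℕ) (s : KZ.IntegralRep (b' + 1 + k')) (M : Fin m' → (Fin (b' + 1) → ℚ) × ℚ) (L : Fin m → (Fin b' → ℚ) × ℚ) (e : Fin m → ℕ) (p : MvPolynomial (Fin (b' + 1)) ℚ) (ℓ : (Fin b' → ℚ) × ℚ) (a : Fin k' → Option ((Fin (b' + 1) → ℚ) × ℚ)) (lo hi : Fin k' → Fin k' ⊕ ((Fin (b' + 1) → ℚ) × ℚ)) (hpole : n ≠ 0 → ∀ z ∈ s.domain, (z (Fin.castAdd k' (Fin.last b')) - (∑ i, (ℓ.1 i : ℝ) * z (Fin.castAdd k' (Fin.castSucc i)) + (ℓ.2 :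 ℝ))) ≠ 0) (hbd : Bornology.IsBounded s.domain) (hdom : s.domain = {z | (∀ j, 0 < ∑ i, ((M j).1 i : ℝ) * z (Fin.castAdd k' i) + ((M j).2 : ℝ)) ∧ ∀ i, Sum.elim (fun j => z (Fin.natAdd (b' + 1) j)) (fun c => ∑ i', (c.1 i' : ℝ) * z (Fin.castAdd k' i') + (c.2 : ℝ)) (lo i) < z (Fin.natAdd (b' + 1) i) ∧ z (Fin.natAdd (b' + 1) i) < Sum.elim (fun j => z (Fin.natAdd (b' + 1) j)) (fun c => ∑ i', (c.1 i' : ℝ) * z (Fin.castAdd k' i') + (c.2 : ℝ)) (hi i)}) (hint : EqOn s.integrand (fun z => MvPolynomial.aeval (fun i => z (Fin.castAdd k' i)) p / (∏ j, (∑ i, ((L j).1 i : ℝ) * z (Fin.castAdd k' (Fin.castSucc i)) + ((L j).2 : ℝ)) ^ e j) * (1 / (z (Fin.castAdd k' (Fin.last b')) - (∑ i, (ℓ.1 i : ℝ) * z (Fin.castAdd k' (Fin.castSucc i)) + (ℓ.2 : ℝ))) ^ n) * ∏ i, (a i).elim 1 (fun c => 1 / (z (Fin.natAdd (b' + 1)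 i) - (∑ i', (c.1 i' : ℝ) * z (Fin.castAdd k' i') + (c.2 : ℝ))))) s.domain) (N : ℕ) (q : ℕ → MvPolynomial (Fin b') ℚ) (hq : ∀ z : Fin (b' + 1 + k') → ℝ, MvPolynomial.aeval (fun i => z (Fin.castAdd k' i)) p = ∑ i ∈ Finset.range N, MvPolynomial.aeval (fun i => z (Fin.castAdd k' (Fin.castSucc i))) (q i) * (z (Fin.castAdd k' (Fin.last b')) - (∑ i, (ℓ.1 i : ℝ) * z (Fin.castAdd k' (Fin.castSucc i)) + (ℓ.2 : ℝ))) ^ i) (hb : b' = b + 2) (hH : ∀ j, e j ≠ 0 → ∀ z ∈ closure s.domain, (∑ i, ((L j).1 i : ℝ) * z (Fin.castAdd k' (Fin.castSucc i)) + ((L j).2 : ℝ)) = 0 → (n ≠ 0 ∧ z (Fin.castAdd k' (Fin.last b')) = ∑ i, (ℓ.1 i : ℝ) * z (Fin.castAdd k' (Fin.castSucc i)) + (ℓ.2 : ℝ))), ∀ i ∈ Finset.range N, IntegrableOn (fun z => MvPolynomial.aeval (fun i => z (Fin.castAdd k' (Fin.castSucc i))) (q i) / (∏ j, (∑ i, ((L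 j).1 i : ℝ) * z (Fin.castAdd k' (Fin.castSucc i)) + ((L j).2 : ℝ)) ^ e j) * ((z (Fin.castAdd k' (Fin.last b')) - (∑ i, (ℓ.1 i : ℝ) * z (Fin.castAdd k' (Fin.castSucc i)) + (ℓ.2 : ℝ))) ^ i / (z (Fin.castAdd k' (Fin.last b')) - (∑ i, (ℓ.1 i : ℝ) * z (Fin.castAdd k' (Fin.castSucc i)) + (ℓ.2 : ℝ))) ^ n) * ∏ i, (a i).elim 1 (fun c => 1 / (z (Fin.natAdd (b' + 1) i) - (∑ i', (c.1 i' : ℝ) * z (Fin.castAdd k' i') + (c.2 : ℝ))))) s.domain) (m m' : ℕ) (s : KZ.IntegralRep (b + 2 + 1 + k)) (M : Fin m' → (Fin (b + 2 + 1) → ℚ) × ℚ) (L : Fin m → (Fin (b + 2 + 1) → ℚ) × ℚ) (e : Fin m → ℕ) (p : MvPolynomial (Fin (b + 2 + 1)) ℚ) (a : Fin k → Option ((Fin (b + 2 + 1) → ℚ) × ℚ)) (lo hi : Fin k → Fin k ⊕ ((Fin (b + 2 + 1) → ℚ) × ℚ)) (hbd : Bornology.IsBounded s.domain) (hdom : s.domain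 = SeparatePos.gDom (b + 2) k m' M lo hi) (hint : EqOn s.integrand (fun z => MvPolynomial.aeval (fun i => z (Fin.castAdd k i)) p / (∏ j, SeparatePos.affF (b + 2) k (L j) z ^ e j) * SeparatePos.fib (b + 2) k a z) s.domain) : ∃ c ∈ AddSubgroup.closure (SeparatePos.GGset (b + 2) 1 k), KZ.of s - c ∈ KZ.relations := by
  classical
  obtain ⟨c, hc, hrel⟩ := separateHigh_fan_active (b + 1) k m m' s M L e p a lo hi hbd hdom hint
  -- it suffices to treat one fan piece
  suffices hpiece : ∀ w ∈ {w : KZ.FormalRep | ∃ (m₁ : ℕ) (M₁ : Fin m₁ → (Fin (b + 1 + 2) → ℚ) × ℚ)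
      (s₁ : KZ.IntegralRep (b + 1 + 2 + k)) (v : Fin (b + 1 + 2) → ℚ), v (Fin.last (b + 1 + 1)) ≠ 0 ∧
      Bornology.IsBounded s₁.domain ∧
      s₁.domain = {z | (∀ j, 0 < ∑ i, ((M₁ j).1 i : ℝ) * z (Fin.castAdd k i) + ((M₁ j).2 : ℝ)) ∧
        ∀ i, Sum.elim (fun j => z (Fin.natAdd (b + 1 + 2) j)) (fun c => ∑ i', (c.1 i' : ℝ) *
          z (Fin.castAdd k i') + (c.2 : ℝ)) (lo i) < z (Fin.natAdd (b + 1 + 2) i) ∧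
          z (Fin.natAdd (b + 1 + 2) i) < Sum.elim (fun j => z (Fin.natAdd (b + 1 + 2) j))
          (fun c => ∑ i', (c.1 i' : ℝ) * z (Fin.castAdd k i') + (c.2 : ℝ)) (hi i)} ∧
      EqOn s₁.integrand (fun z => MvPolynomial.aeval (fun i => z (Fin.castAdd k i)) p /
        (∏ j, (∑ i, ((L j).1 i : ℝ) * z (Fin.castAdd k i) + ((L j).2 : ℝ)) ^ e j) *
        ∏ i, (a i).elim 1 (fun c => 1 / (z (Fin.natAdd (b + 1 + 2) i) -
          (∑ i', (c.1 i' : ℝ) * z (Fin.castAdd k i') + (c.2 : ℝ))))) s₁.domain ∧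
      s₁.domain ⊆ s.domain ∧
      (∀ j, e j ≠ 0 → (L j).1 ≠ 0 → (∑ i, (L j).1 i * v i) ≠ 0) ∧
      (∀ j, (∑ i, (L j).1 i * v i) ≠ 0 → e j ≠ 0 → ∀ z ∈ s₁.domain,
        ∑ i, ((L j).1 i : ℝ) * z (Fin.castAdd k i) + ((L j).2 : ℝ) ≠ 0) ∧
      (∀ j j', (∑ i, (L j).1 i * v i) ≠ 0 → (∑ i, (L j').1 i * v i) ≠ 0 → e j ≠ 0 → e j' ≠ 0 →
        (∑ i, (L j').1 i * v i) • L j ≠ (∑ i, (L j).1 i * v i) • L j' →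
        ∃ C : ℝ, ∀ z ∈ s₁.domain, |∑ i, ((L j').1 i : ℝ) * z (Fin.castAdd k i) + ((L j').2 : ℝ)| ≤
          C * |(((∑ i, (L j).1 i * v i) : ℚ) : ℝ) * (∑ i, ((L j').1 i : ℝ) * z (Fin.castAdd k i) +
            ((L j').2 : ℝ)) - (((∑ i, (L j').1 i * v i) : ℚ) : ℝ) *
            (∑ i, ((L j).1 i : ℝ) * z (Fin.castAdd k i) + ((L j).2 : ℝ))|) ∧
      w = KZ.of s₁}, ∃ c' ∈ AddSubgroup.closure (GGset (b + 2) 1 k), w - c' ∈ KZ.relations by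
    obtain ⟨c', hc', hcc⟩ := SepTwoZero.closure_transfer' hpiece c hc
    refine ⟨c', hc', ?_⟩
    have := add_mem hrel hcc
    rwa [sub_add_sub_cancel] at this
  rintro w ⟨m₁, M₁, s₁, v, hv, hbd₁, hdom₁, hint₁, -, hactv, hpolev, hratv, rfl⟩
  -- the base change along `v` (fibres untouched, no cut)
  obtain ⟨hA', hA⟩ := dirAinv_mul_inv (n := b + 1 + 1) v hv
  obtain ⟨M', L', p', a', lo', hi', s', -, hL', -, -, -, -, hΨ, hbd', hdom', hint', hrel'⟩ :=
    separatePos_baseChange (b + 1 + 2) k m m₁ s₁ M₁ L e p a lo hi hbd₁ hdom₁ hint₁ (dirAinv v)⁻¹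
      (dirAinv v) hA hA'
  have hform : ∀ j w, affF (b + 2) k (L' j) w =
      ∑ i, ((L j).1 i : ℝ) * (Fin.append (fun j => ∑ i, (dirAinv v j i : ℝ) * w (Fin.castAdd k i))
        (fun i => w (Fin.natAdd (b + 1 + 2) i)) : Fin (b + 1 + 2 + k) → ℝ) (Fin.castAdd k i) +
        ((L j).2 : ℝ) := fun j w => by
    rw [hL']; exact (form_sub (dirAinv v) (L j) w).symm
  have hlast : ∀ j, (L' j).1 (Fin.last (b + 2)) = ∑ i, (L j).1 i * v i := fun j => by
    rw [hL']; exact vecMul_dirAinv_last _ _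
  -- the contact-aware engine on the transformed piece (part `KPiece`)
  have key : ∃ c' ∈ AddSubgroup.closure (GGset (b + 2) 1 k), KZ.of s' - c' ∈ KZ.relations := by
    refine SepThreeK.piece hHb s' M' L' e p' a' lo' hi' hbd' hdom' hint'
      (fun j he hLj => ?_) (fun j hα he w hw => ?_) (fun j j' hα hα' he he' hne => ?_)
    · -- every active non-constant letter is a `y`-letter
      rw [hlast]
      refine hactv j he fun h0 => hLj ?_
      rw [hL', h0]
      simp
    · -- active `y`-letters do not vanish on the piece
      rw [hlast] at hα
      rw [hform]
      exact hpolev j hα he _ ((hΨ w).1 hw)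
    · -- the ratio condition
      rw [hlast] at hα hα'
      have hne' : (∑ i, (L j').1 i * v i) • L j ≠ (∑ i, (L j).1 i * v i) • L j' := fun h => by
        refine hne ?_
        rw [hlast, hlast, hL', hL']
        have h2 :=
          congrArg (fun c : (Fin (b + 1 + 2) → ℚ) × ℚ => (Matrix.vecMul c.1 (dirAinv v), c.2)) h
        simpa only [Prod.smul_fst, Prod.smul_snd, Matrix.smul_vecMul, Prod.smul_mk] using h2
      obtain ⟨C, hC⟩ := hratv j j' hα hα' he he' hne'
      refine ⟨C, fun w hw => ?_⟩
      have h := hC _ ((hΨ w).1 hw)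
      rw [hform, hform, hlast, hlast]
      exact h
  obtain ⟨c', hc', hr⟩ := key
  refine ⟨c', hc', ?_⟩
  have := add_mem hrel' hr
  rwa [sub_add_sub_cancel] at this

/-- **`JJ (b + 3) k → closure (GG (b + 2) 1 k)` for every `b`, `k`, modulo the wall-invariant
convergence lemma in engine base dimension `b + 3`, in the stub's vocabulary** (`JJ`, `GG` through
`hJJ`, `hGG` exactly as in `stub_separateHigh`): the stub `stub_separateHigh` follows from the
family of analytic lemmas `hH_{b+2}` alone. -/
theorem separateHigh_of_hH (JJ : ℕ → ℕ → Set KZ.FormalRep) (GG : ℕ → ℕ → ℕ → Set KZ.FormalRep) (hJJ : ∀ b k, JJ b k = {w : KZ.FormalRep | ∃ (m m' : ℕ) (s : KZ.IntegralRep (b + k)) (M : Fin m' → (Fin b → ℚ) × ℚ) (L : Fin m → (Fin b → ℚ) × ℚ) (e : Fin m → ℕ) (p : MvPolynomial (Fin b) ℚ) (a : Fin k → Option ((Fin b → ℚ) × ℚ)) (lo hi : Fin k → Fin k ⊕ ((Fin b → ℚ) × ℚ)), Bornology.IsBounded s.domain ∧ s.domain = {z | (∀ j, 0 < ∑ i,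 ((M j).1 i : ℝ) * z (Fin.castAdd k i) + ((M j).2 : ℝ)) ∧ ∀ i, Sum.elim (fun j => z (Fin.natAdd b j)) (fun c => ∑ i', (c.1 i' : ℝ) * z (Fin.castAdd k i') + (c.2 : ℝ)) (lo i) < z (Fin.natAdd b i) ∧ z (Fin.natAdd b i) < Sum.elim (fun j => z (Fin.natAdd b j)) (fun c => ∑ i', (c.1 i' : ℝ) * z (Fin.castAdd k i') + (c.2 : ℝ)) (hi i)} ∧ EqOn s.integrand (fun z => MvPolynomial.aeval (fun i => z (Fin.castAdd k i)) p / (∏ j, (∑ i, ((L j).1 i : ℝ) * z (Fin.castAdd k i) + ((L j).2 : ℝ)) ^ e j) * ∏ i, (a i).elim 1 (fun c => 1 / (z (Fin.natAdd b i) - (∑ i', (c.1 i' : ℝ) * z (Fin.castAdd k i') + (c.2 : ℝ))))) s.domain ∧ w = KZ.of s}) (hGG : ∀ b σ k, GG b σ k = {w : KZ.FormalRep | ∃ (m m' n₁ n₂ : ℕ) (s : KZ.IntegralRep (b + 1 + k)) (M : Fin m' → (Fin (b + 1) → ℚ) × ℚ) (L : Fin m → (Fin b → ℚ) × ℚ)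 (e : Fin m → ℕ) (p : MvPolynomial (Fin b) ℚ) (ℓ₁ ℓ₂ : (Fin b → ℚ) × ℚ) (a : Fin k → Option ((Fin (b + 1) → ℚ) × ℚ)) (lo hi : Fin k → Fin k ⊕ ((Fin (b + 1) → ℚ) × ℚ)), (n₁ = 0 ∨ n₂ = 0) ∧ (σ = 2 → (∀ i c, a i = some c → c.1 (Fin.last b) = 0) ∧ (∀ i c, (lo i = Sum.inr c ∨ hi i = Sum.inr c) → (c.1 (Fin.last b) = 0 ∨ c = (Pi.single (Fin.last b) 1, 0)))) ∧ Bornology.IsBounded s.domain ∧ s.domain = {z | (∀ j, 0 < ∑ i, ((M j).1 i : ℝ) * z (Fin.castAdd k i) + ((M j).2 : ℝ)) ∧ ∀ i, Sum.elim (fun j => z (Fin.natAdd (b + 1) j)) (fun c => ∑ i', (c.1 i' : ℝ) * z (Fin.castAdd k i') + (c.2 : ℝ)) (lo i) < z (Fin.natAdd (b + 1) i) ∧ z (Fin.natAdd (b + 1) i) < Sum.elim (fun j => z (Fin.natAdd (b + 1) j)) (fun c => ∑ i', (c.1 i' : ℝ) * z (Fin.castAdd k i') + (c.2 : ℝ))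 (hi i)} ∧ EqOn s.integrand (fun z => MvPolynomial.aeval (fun i => z (Fin.castAdd k (Fin.castSucc i))) p / (∏ j, (∑ i, ((L j).1 i : ℝ) * z (Fin.castAdd k (Fin.castSucc i)) + ((L j).2 : ℝ)) ^ e j) * ((z (Fin.castAdd k (Fin.last b)) - (∑ i, (ℓ₁.1 i : ℝ) * z (Fin.castAdd k (Fin.castSucc i)) + (ℓ₁.2 : ℝ))) ^ n₁ / (z (Fin.castAdd k (Fin.last b)) - (∑ i, (ℓ₂.1 i : ℝ) * z (Fin.castAdd k (Fin.castSucc i)) + (ℓ₂.2 : ℝ))) ^ n₂) * ∏ i, (a i).elim 1 (fun c => 1 / (z (Fin.natAdd (b + 1) i) - (∑ i', (c.1 i' : ℝ) * z (Fin.castAdd k i') + (c.2 : ℝ))))) s.domain ∧ w = KZ.of s}) (b k : ℕ) (hHb : ∀ (b' k' m m' n : ℕ) (s : KZ.IntegralRep (b' + 1 + k')) (M : Fin m' → (Fin (b' + 1) → ℚ) × ℚ) (L : Fin m → (Fin b' → ℚ) × ℚ) (e : Fin m → ℕ) (p : MvPolynomial (Fin (b' + 1)) ℚ) (ℓ : (Fin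 b' → ℚ) × ℚ) (a : Fin k' → Option ((Fin (b' + 1) → ℚ) × ℚ)) (lo hi : Fin k' → Fin k' ⊕ ((Fin (b' + 1) → ℚ) × ℚ)) (hpole : n ≠ 0 → ∀ z ∈ s.domain, (z (Fin.castAdd k' (Fin.last b')) - (∑ i, (ℓ.1 i : ℝ) * z (Fin.castAdd k' (Fin.castSucc i)) + (ℓ.2 : ℝ))) ≠ 0) (hbd : Bornology.IsBounded s.domain) (hdom : s.domain = {z | (∀ j, 0 < ∑ i, ((M j).1 i : ℝ) * z (Fin.castAdd k' i) + ((M j).2 : ℝ)) ∧ ∀ i, Sum.elim (fun j => z (Fin.natAdd (b' + 1) j)) (fun c => ∑ i', (c.1 i' : ℝ) * z (Fin.castAdd k' i') + (c.2 : ℝ)) (lo i) < z (Fin.natAdd (b' + 1) i) ∧ z (Fin.natAdd (b' + 1) i) < Sum.elim (fun j => z (Fin.natAdd (b' + 1) j)) (fun c => ∑ i', (c.1 i' : ℝ) * z (Fin.castAdd k' i') + (c.2 : ℝ)) (hi i)}) (hint : EqOn s.integrand (fun z => MvPolynomial.aeval (fun i => z (Fin.castAdd k' i)) p / (∏ j,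 (∑ i, ((L j).1 i : ℝ) * z (Fin.castAdd k' (Fin.castSucc i)) + ((L j).2 : ℝ)) ^ e j) * (1 / (z (Fin.castAdd k' (Fin.last b')) - (∑ i, (ℓ.1 i : ℝ) * z (Fin.castAdd k' (Fin.castSucc i)) + (ℓ.2 : ℝ))) ^ n) * ∏ i, (a i).elim 1 (fun c => 1 / (z (Fin.natAdd (b' + 1) i) - (∑ i', (c.1 i' : ℝ) * z (Fin.castAdd k' i') + (c.2 : ℝ))))) s.domain) (N : ℕ) (q : ℕ → MvPolynomial (Fin b') ℚ) (hq : ∀ z : Fin (b' + 1 + k') → ℝ, MvPolynomial.aeval (fun i => z (Fin.castAdd k' i)) p = ∑ i ∈ Finset.range N, MvPolynomial.aeval (fun i => z (Fin.castAdd k' (Fin.castSucc i))) (q i) * (z (Fin.castAdd k' (Fin.last b')) - (∑ i, (ℓ.1 i : ℝ) * z (Fin.castAdd k' (Fin.castSucc i)) + (ℓ.2 : ℝ))) ^ i) (hb : b' = b + 2) (hH : ∀ j, e j ≠ 0 → ∀ z ∈ closure s.domain, (∑ i, ((L j).1 i : ℝ) * z (Fin.castAdd k' (Fin.castSucc i))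 + ((L j).2 : ℝ)) = 0 → (n ≠ 0 ∧ z (Fin.castAdd k' (Fin.last b')) = ∑ i, (ℓ.1 i : ℝ) * z (Fin.castAdd k' (Fin.castSucc i)) + (ℓ.2 : ℝ))), ∀ i ∈ Finset.range N, IntegrableOn (fun z => MvPolynomial.aeval (fun i => z (Fin.castAdd k' (Fin.castSucc i))) (q i) / (∏ j, (∑ i, ((L j).1 i : ℝ) * z (Fin.castAdd k' (Fin.castSucc i)) + ((L j).2 : ℝ)) ^ e j) * ((z (Fin.castAdd k' (Fin.last b')) - (∑ i, (ℓ.1 i : ℝ) * z (Fin.castAdd k' (Fin.castSucc i)) + (ℓ.2 : ℝ))) ^ i / (z (Fin.castAdd k' (Fin.last b')) - (∑ i, (ℓ.1 i : ℝ) * z (Fin.castAdd k' (Fin.castSucc i)) + (ℓ.2 : ℝ))) ^ n) * ∏ i, (a i).elim 1 (fun c => 1 / (z (Fin.natAdd (b' + 1) i) - (∑ i', (c.1 i' : ℝ) * z (Fin.castAdd k' i') + (c.2 : ℝ))))) s.domain) : ∀ x ∈ JJ (b + 3) k, ∃ c ∈ AddSubgroup.closure (GG (b + 2) 1 k), x -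 c ∈ KZ.relations := by
  intro x hx
  rw [hJJ] at hx
  obtain ⟨m, m', s, M, L, e, p, a, lo, hi, hbd, hdom, hint, rfl⟩ := hx
  rw [show GG (b + 2) 1 k = SeparatePos.GGset (b + 2) 1 k from hGG (b + 2) 1 k]
  exact separateThreeK_of_hH b k hHb m m' s M L e p a lo hi hbd hdom hint

/-- **Base dimension `3`, every number `k` of fibres** (`JJ 3 k → closure (GG 2 1 k)`), modulo
the wall-invariant convergence lemma `hHk` (VERBATIM the statement of `separateThree_hHk`: the
registered statement of `stub_separateTwoPos_hI` with `(hb : b = 2)`). -/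
theorem separateHigh_three_of_hHk (JJ : ℕ → ℕ → Set KZ.FormalRep) (GG : ℕ → ℕ → ℕ → Set KZ.FormalRep) (hJJ : ∀ b k, JJ b k = {w : KZ.FormalRep | ∃ (m m' : ℕ) (s : KZ.IntegralRep (b + k)) (M : Fin m' → (Fin b → ℚ) × ℚ) (L : Fin m → (Fin b → ℚ) × ℚ) (e : Fin m → ℕ) (p : MvPolynomial (Fin b) ℚ) (a : Fin k → Option ((Fin b → ℚ) × ℚ)) (lo hi : Fin k → Fin k ⊕ ((Fin b → ℚ) × ℚ)), Bornology.IsBounded s.domain ∧ s.domain = {z | (∀ j, 0 < ∑ i, ((M j).1 i : ℝ) * z (Fin.castAdd k i) + ((M j).2 : ℝ)) ∧ ∀ i, Sum.elim (fun j => z (Fin.natAdd b j)) (fun c => ∑ i', (c.1 i' : ℝ) * z (Fin.castAdd k i') + (c.2 : ℝ)) (lo i) < z (Fin.natAdd b i) ∧ z (Fin.natAdd b i) < Sum.elim (fun j => z (Fin.natAdd b j)) (fun c => ∑ i', (c.1 i' : ℝ) * z (Fin.castAdd k i') + (c.2 : ℝ)) (hi i)} ∧ EqOn s.integrand (fun z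 => MvPolynomial.aeval (fun i => z (Fin.castAdd k i)) p / (∏ j, (∑ i, ((L j).1 i : ℝ) * z (Fin.castAdd k i) + ((L j).2 : ℝ)) ^ e j) * ∏ i, (a i).elim 1 (fun c => 1 / (z (Fin.natAdd b i) - (∑ i', (c.1 i' : ℝ) * z (Fin.castAdd k i') + (c.2 : ℝ))))) s.domain ∧ w = KZ.of s}) (hGG : ∀ b σ k, GG b σ k = {w : KZ.FormalRep | ∃ (m m' n₁ n₂ : ℕ) (s : KZ.IntegralRep (b + 1 + k)) (M : Fin m' → (Fin (b + 1) → ℚ) × ℚ) (L : Fin m → (Fin b → ℚ) × ℚ) (e : Fin m → ℕ) (p : MvPolynomial (Fin b) ℚ) (ℓ₁ ℓ₂ : (Fin b → ℚ) × ℚ) (a : Fin k → Option ((Fin (b + 1) → ℚ) × ℚ)) (lo hi : Fin k → Fin k ⊕ ((Fin (b + 1) → ℚ) × ℚ)), (n₁ = 0 ∨ n₂ = 0) ∧ (σ = 2 → (∀ i c, a i = some c → c.1 (Fin.last b) = 0) ∧ (∀ i c, (lo i = Sum.inr c ∨ hi i = Sum.inr c) → (c.1 (Fin.last b) = 0 ∨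 c = (Pi.single (Fin.last b) 1, 0)))) ∧ Bornology.IsBounded s.domain ∧ s.domain = {z | (∀ j, 0 < ∑ i, ((M j).1 i : ℝ) * z (Fin.castAdd k i) + ((M j).2 : ℝ)) ∧ ∀ i, Sum.elim (fun j => z (Fin.natAdd (b + 1) j)) (fun c => ∑ i', (c.1 i' : ℝ) * z (Fin.castAdd k i') + (c.2 : ℝ)) (lo i) < z (Fin.natAdd (b + 1) i) ∧ z (Fin.natAdd (b + 1) i) < Sum.elim (fun j => z (Fin.natAdd (b + 1) j)) (fun c => ∑ i', (c.1 i' : ℝ) * z (Fin.castAdd k i') + (c.2 : ℝ)) (hi i)} ∧ EqOn s.integrand (fun z => MvPolynomial.aeval (fun i => z (Fin.castAdd k (Fin.castSucc i))) p / (∏ j, (∑ i, ((L j).1 i : ℝ) * z (Fin.castAdd k (Fin.castSucc i)) + ((L j).2 : ℝ)) ^ e j) * ((z (Fin.castAdd k (Fin.last b)) - (∑ i, (ℓ₁.1 i : ℝ) * z (Fin.castAdd k (Fin.castSucc i)) + (ℓ₁.2 : ℝ))) ^ n₁ / (z (Fin.castAdd k (Fin.last b)) - (∑ i, (ℓ₂.1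 i : ℝ) * z (Fin.castAdd k (Fin.castSucc i)) + (ℓ₂.2 : ℝ))) ^ n₂) * ∏ i, (a i).elim 1 (fun c => 1 / (z (Fin.natAdd (b + 1) i) - (∑ i', (c.1 i' : ℝ) * z (Fin.castAdd k i') + (c.2 : ℝ))))) s.domain ∧ w = KZ.of s}) (hHk : ∀ (b k m m' n : ℕ) (s : KZ.IntegralRep (b + 1 + k)) (M : Fin m' → (Fin (b + 1) → ℚ) × ℚ) (L : Fin m → (Fin b → ℚ) × ℚ) (e : Fin m → ℕ) (p : MvPolynomial (Fin (b + 1)) ℚ) (ℓ : (Fin b → ℚ) × ℚ) (a : Fin k → Option ((Fin (b + 1) → ℚ) × ℚ)) (lo hi : Fin k → Fin k ⊕ ((Fin (b + 1) → ℚ) × ℚ)) (hpole : n ≠ 0 → ∀ z ∈ s.domain, (z (Fin.castAdd k (Fin.last b)) - (∑ i, (ℓ.1 i : ℝ) * z (Fin.castAdd k (Fin.castSucc i)) + (ℓ.2 : ℝ))) ≠ 0) (hbd : Bornology.IsBounded s.domain) (hdom : s.domain = {z | (∀ j, 0 < ∑ i, ((M j).1 i : ℝ) * z (Fin.castAdd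 k i) + ((M j).2 : ℝ)) ∧ ∀ i, Sum.elim (fun j => z (Fin.natAdd (b + 1) j)) (fun c => ∑ i', (c.1 i' : ℝ) * z (Fin.castAdd k i') + (c.2 : ℝ)) (lo i) < z (Fin.natAdd (b + 1) i) ∧ z (Fin.natAdd (b + 1) i) < Sum.elim (fun j => z (Fin.natAdd (b + 1) j)) (fun c => ∑ i', (c.1 i' : ℝ) * z (Fin.castAdd k i') + (c.2 : ℝ)) (hi i)}) (hint : EqOn s.integrand (fun z => MvPolynomial.aeval (fun i => z (Fin.castAdd k i)) p / (∏ j, (∑ i, ((L j).1 i : ℝ) * z (Fin.castAdd k (Fin.castSucc i)) + ((L j).2 : ℝ)) ^ e j) * (1 / (z (Fin.castAdd k (Fin.last b)) - (∑ i, (ℓ.1 i : ℝ) * z (Fin.castAdd k (Fin.castSucc i)) + (ℓ.2 : ℝ))) ^ n) * ∏ i, (a i).elim 1 (fun c => 1 / (z (Fin.natAdd (b + 1) i) - (∑ i', (c.1 i' : ℝ) * z (Fin.castAdd k i') + (c.2 : ℝ))))) s.domain) (N : ℕ) (q : ℕ → MvPolynomial (Fin b) ℚ) (hq : ∀ z :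 Fin (b + 1 + k) → ℝ, MvPolynomial.aeval (fun i => z (Fin.castAdd k i)) p = ∑ i ∈ Finset.range N, MvPolynomial.aeval (fun i => z (Fin.castAdd k (Fin.castSucc i))) (q i) * (z (Fin.castAdd k (Fin.last b)) - (∑ i, (ℓ.1 i : ℝ) * z (Fin.castAdd k (Fin.castSucc i)) + (ℓ.2 : ℝ))) ^ i) (hb : b = 2) (hH : ∀ j, e j ≠ 0 → ∀ z ∈ closure s.domain, (∑ i, ((L j).1 i : ℝ) * z (Fin.castAdd k (Fin.castSucc i)) + ((L j).2 : ℝ)) = 0 → (n ≠ 0 ∧ z (Fin.castAdd k (Fin.last b)) = ∑ i, (ℓ.1 i : ℝ) * z (Fin.castAdd k (Fin.castSucc i)) + (ℓ.2 : ℝ))), ∀ i ∈ Finset.range N, IntegrableOn (fun z => MvPolynomial.aeval (fun i => z (Fin.castAdd k (Fin.castSucc i))) (q i) / (∏ j, (∑ i, ((L j).1 i : ℝ) * z (Fin.castAdd k (Fin.castSucc i)) + ((L j).2 : ℝ)) ^ e j) * ((z (Fin.castAdd k (Fin.last b)) - (∑ i, (ℓ.1 i : ℝ) * z (Fin.castAdd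 k (Fin.castSucc i)) + (ℓ.2 : ℝ))) ^ i / (z (Fin.castAdd k (Fin.last b)) - (∑ i, (ℓ.1 i : ℝ) * z (Fin.castAdd k (Fin.castSucc i)) + (ℓ.2 : ℝ))) ^ n) * ∏ i, (a i).elim 1 (fun c => 1 / (z (Fin.natAdd (b + 1) i) - (∑ i', (c.1 i' : ℝ) * z (Fin.castAdd k i') + (c.2 : ℝ))))) s.domain) (k : ℕ) : ∀ x ∈ JJ 3 k, ∃ c ∈ AddSubgroup.closure (GG 2 1 k), x - c ∈ KZ.relations :=
  separateHigh_of_hH JJ GG hJJ hGG 0 k hHk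

/-- **Base dimension `3` WITH fibres** (`JJ 3 (k + 1) → closure (GG 2 1 (k + 1))`, the
with-fibres part of `stub_separateHigh`; the fibre-free part is `stub_separateThreeZero`), modulo
the wall-invariant convergence lemma `hHk` (VERBATIM the statement of `separateThree_hHk`: the
registered statement of `stub_separateTwoPos_hI` with `(hb : b = 2)`), universally closed,
exactly as `separateThreeZero_of_hI3` takes `hHI₃`. -/
theorem separateHigh_threeFibres_of_hHk (JJ : ℕ → ℕ → Set KZ.FormalRep) (GG : ℕ → ℕ → ℕ → Set KZ.FormalRep) (hJJ : ∀ b k, JJ b k = {w : KZ.FormalRep | ∃ (m m' : ℕ) (s : KZ.IntegralRep (b + k)) (M : Fin m' → (Fin b → ℚ) × ℚ) (L : Fin m → (Fin b → ℚ) × ℚ) (e : Fin m → ℕ) (p : MvPolynomial (Fin b) ℚ) (a : Fin k → Option ((Fin b → ℚ) × ℚ)) (lo hi : Fin k → Fin k ⊕ ((Fin b → ℚ) × ℚ)), Bornology.IsBounded s.domain ∧ s.domain = {z | (∀ j, 0 < ∑ i, ((M j).1 i : ℝ) * z (Fin.castAdd k i) + ((M j).2 : ℝ)) ∧ ∀ i,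 Sum.elim (fun j => z (Fin.natAdd b j)) (fun c => ∑ i', (c.1 i' : ℝ) * z (Fin.castAdd k i') + (c.2 : ℝ)) (lo i) < z (Fin.natAdd b i) ∧ z (Fin.natAdd b i) < Sum.elim (fun j => z (Fin.natAdd b j)) (fun c => ∑ i', (c.1 i' : ℝ) * z (Fin.castAdd k i') + (c.2 : ℝ)) (hi i)} ∧ EqOn s.integrand (fun z => MvPolynomial.aeval (fun i => z (Fin.castAdd k i)) p / (∏ j, (∑ i, ((L j).1 i : ℝ) * z (Fin.castAdd k i) + ((L j).2 : ℝ)) ^ e j) * ∏ i, (a i).elim 1 (fun c => 1 / (z (Fin.natAdd b i) - (∑ i', (c.1 i' : ℝ) * z (Fin.castAdd k i') + (c.2 : ℝ))))) s.domain ∧ w = KZ.of s}) (hGG : ∀ b σ k, GG b σ k = {w : KZ.FormalRep | ∃ (m m' n₁ n₂ : ℕ) (s : KZ.IntegralRep (b + 1 + k)) (M : Fin m' → (Fin (b + 1) → ℚ) × ℚ) (L : Fin m → (Fin b → ℚ) × ℚ) (e : Fin m → ℕ) (p : MvPolynomial (Fin b) ℚ) (ℓ₁ ℓ₂ : (Fin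 b → ℚ) × ℚ) (a : Fin k → Option ((Fin (b + 1) → ℚ) × ℚ)) (lo hi : Fin k → Fin k ⊕ ((Fin (b + 1) → ℚ) × ℚ)), (n₁ = 0 ∨ n₂ = 0) ∧ (σ = 2 → (∀ i c, a i = some c → c.1 (Fin.last b) = 0) ∧ (∀ i c, (lo i = Sum.inr c ∨ hi i = Sum.inr c) → (c.1 (Fin.last b) = 0 ∨ c = (Pi.single (Fin.last b) 1, 0)))) ∧ Bornology.IsBounded s.domain ∧ s.domain = {z | (∀ j, 0 < ∑ i, ((M j).1 i : ℝ) * z (Fin.castAdd k i) + ((M j).2 : ℝ)) ∧ ∀ i, Sum.elim (fun j => z (Fin.natAdd (b + 1) j)) (fun c => ∑ i', (c.1 i' : ℝ) * z (Fin.castAdd k i') + (c.2 : ℝ)) (lo i) < z (Fin.natAdd (b + 1) i) ∧ z (Fin.natAdd (b + 1) i) < Sum.elim (fun j => z (Fin.natAdd (b + 1) j)) (fun c => ∑ i', (c.1 i' : ℝ) * z (Fin.castAdd k i') + (c.2 : ℝ)) (hi i)} ∧ EqOn s.integrand (fun z => MvPolynomial.aeval (fun i => z (Fin.castAdd k (Fin.castSucc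 i))) p / (∏ j, (∑ i, ((L j).1 i : ℝ) * z (Fin.castAdd k (Fin.castSucc i)) + ((L j).2 : ℝ)) ^ e j) * ((z (Fin.castAdd k (Fin.last b)) - (∑ i, (ℓ₁.1 i : ℝ) * z (Fin.castAdd k (Fin.castSucc i)) + (ℓ₁.2 : ℝ))) ^ n₁ / (z (Fin.castAdd k (Fin.last b)) - (∑ i, (ℓ₂.1 i : ℝ) * z (Fin.castAdd k (Fin.castSucc i)) + (ℓ₂.2 : ℝ))) ^ n₂) * ∏ i, (a i).elim 1 (fun c => 1 / (z (Fin.natAdd (b + 1) i) - (∑ i', (c.1 i' : ℝ) * z (Fin.castAdd k i') + (c.2 : ℝ))))) s.domain ∧ w = KZ.of s}) (hHk : ∀ (b k m m' n : ℕ) (s : KZ.IntegralRep (b + 1 + k)) (M : Fin m' → (Fin (b + 1) → ℚ) × ℚ) (L : Fin m → (Fin b → ℚ) × ℚ) (e : Fin m → ℕ) (p : MvPolynomial (Fin (b + 1)) ℚ) (ℓ : (Fin b → ℚ) × ℚ) (a : Fin k → Option ((Fin (b + 1) → ℚ) × ℚ)) (lo hi : Fin k → Fin k ⊕ ((Fin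 (b + 1) → ℚ) × ℚ)) (hpole : n ≠ 0 → ∀ z ∈ s.domain, (z (Fin.castAdd k (Fin.last b)) - (∑ i, (ℓ.1 i : ℝ) * z (Fin.castAdd k (Fin.castSucc i)) + (ℓ.2 : ℝ))) ≠ 0) (hbd : Bornology.IsBounded s.domain) (hdom : s.domain = {z | (∀ j, 0 < ∑ i, ((M j).1 i : ℝ) * z (Fin.castAdd k i) + ((M j).2 : ℝ)) ∧ ∀ i, Sum.elim (fun j => z (Fin.natAdd (b + 1) j)) (fun c => ∑ i', (c.1 i' : ℝ) * z (Fin.castAdd k i') + (c.2 : ℝ)) (lo i) < z (Fin.natAdd (b + 1) i) ∧ z (Fin.natAdd (b + 1) i) < Sum.elim (fun j => z (Fin.natAdd (b + 1) j)) (fun c => ∑ i', (c.1 i' : ℝ) * z (Fin.castAdd k i') + (c.2 : ℝ)) (hi i)}) (hint : EqOn s.integrand (fun z => MvPolynomial.aeval (fun i => z (Fin.castAdd k i)) p / (∏ j, (∑ i, ((L j).1 i : ℝ) * z (Fin.castAdd k (Fin.castSucc i)) + ((L j).2 : ℝ)) ^ e j) * (1 / (z (Fin.castAdd k (Fin.last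 b)) - (∑ i, (ℓ.1 i : ℝ) * z (Fin.castAdd k (Fin.castSucc i)) + (ℓ.2 : ℝ))) ^ n) * ∏ i, (a i).elim 1 (fun c => 1 / (z (Fin.natAdd (b + 1) i) - (∑ i', (c.1 i' : ℝ) * z (Fin.castAdd k i') + (c.2 : ℝ))))) s.domain) (N : ℕ) (q : ℕ → MvPolynomial (Fin b) ℚ) (hq : ∀ z : Fin (b + 1 + k) → ℝ, MvPolynomial.aeval (fun i => z (Fin.castAdd k i)) p = ∑ i ∈ Finset.range N, MvPolynomial.aeval (fun i => z (Fin.castAdd k (Fin.castSucc i))) (q i) * (z (Fin.castAdd k (Fin.last b)) - (∑ i, (ℓ.1 i : ℝ) * z (Fin.castAdd k (Fin.castSucc i)) + (ℓ.2 : ℝ))) ^ i) (hb : b = 2) (hH : ∀ j, e j ≠ 0 → ∀ z ∈ closure s.domain, (∑ i, ((L j).1 i : ℝ) * z (Fin.castAdd k (Fin.castSucc i)) + ((L j).2 : ℝ)) = 0 → (n ≠ 0 ∧ z (Fin.castAdd k (Fin.last b)) = ∑ i, (ℓ.1 i : ℝ) * z (Fin.castAdd k (Fin.castSucc i)) + (ℓ.2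 : ℝ))), ∀ i ∈ Finset.range N, IntegrableOn (fun z => MvPolynomial.aeval (fun i => z (Fin.castAdd k (Fin.castSucc i))) (q i) / (∏ j, (∑ i, ((L j).1 i : ℝ) * z (Fin.castAdd k (Fin.castSucc i)) + ((L j).2 : ℝ)) ^ e j) * ((z (Fin.castAdd k (Fin.last b)) - (∑ i, (ℓ.1 i : ℝ) * z (Fin.castAdd k (Fin.castSucc i)) + (ℓ.2 : ℝ))) ^ i / (z (Fin.castAdd k (Fin.last b)) - (∑ i, (ℓ.1 i : ℝ) * z (Fin.castAdd k (Fin.castSucc i)) + (ℓ.2 : ℝ))) ^ n) * ∏ i, (a i).elim 1 (fun c => 1 / (z (Fin.natAdd (b + 1) i) - (∑ i', (c.1 i' : ℝ) * z (Fin.castAdd k i') + (c.2 : ℝ))))) s.domain) (k : ℕ) : ∀ x ∈ JJ 3 (k + 1), ∃ c ∈ AddSubgroup.closure (GG 2 1 (k + 1)), x - c ∈ KZ.relations :=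
  separateHigh_of_hH JJ GG hJJ hGG 0 (k + 1) hHk

end Summit.KontsevichZagierPeriods.ArrangementNormalForm.JanusBands
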